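import Summits.BirchSwinnertonDyer.BirchSwinnertonDyer.Theorems.ByReductionTypeAtTwoAdditivePotGoodPrintFamily56b1Thm15
import Literature.NumberTheory.EllipticCurves.Curve6137TwoIsogenyDescent
import Literature.NumberTheory.EllipticCurves.TwoIsogenySelmerGroupRankProofs
import Literature.NumberTheory.EllipticCurves.IsogenyMordellWeilRankProofs
import Literature.NumberTheory.EllipticCurves.SelmerCorankIsogenyProofs
import Literature.NumberTheory.EllipticCurves.IwasawaLeadingTermProofs
import HarnessLib

/-!
# K4 crux `AdditiveRankZeroAtTwo` (19098), children C3″ (22617) / C2″ (22616): the `56b1` Thm-1.5 road with the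
# certificate `Ш(E′)[2] = 0` DISCHARGED IN THE KERNEL — a complete `2`-descent on `E′ = 56b1/⟨T⟩ : y² = x³ − 10x² − 7x`

Cell `bsd-2adic`, seat `bsd-2adic-k4-w2` GEN 5 (prover, explicit unit, no kit); `--supports stmt-BirchSwinnertonDyer-22617
--as helper`. HONEST FRAMING (D-0036/D-0054): `…PrintFamily56b1Thm15.lean` (p681865/p682115) proves BSD₂ (both halves,
`Ш(W)(2) = 0`) on the `2N`-split sub-family of `56b1^{(∏Q)}` from CLZ Thm. 1.1 + 1.5 (PROVED theorems) and ARS Thm. 2.6,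
displaying four base data: the optimal datum, `ord₂ L^alg(56b1) = −1`, `BSD(56b1, 2)`, and the CERTIFICATE `Ш(E′)[2] = 0`
for the `2`-isogenous curve `E′ = [0,−10,0,−7,0]`. THIS FILE removes the last one: Silverman's descent via `2`-isogeny
(AEC X.4.9) on `E′` is SHARP — `S^{(φ)}(−10,−7) ⊆ {1, −7}` (the classes `−1`, `7` have no point modulo `16`) and
`S^{(φ̂)} = S(20, 128) ⊆ {1, 2}` (the classes `−1`, `−2` have no point modulo `7`), so `dim₂ S + dim₂ S′ ≤ 2 ≤ rank + 2`
and the tree's `forall_mem_sha_two_smul_eq_zero_of_selmerRank_add_le` (AEC X.4.7 + X.4.2(a)) gives `Ш(E′/ℚ)[2] = 0`;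
on the way `rank E′(ℚ) = 0` and, by isogeny invariance, **`rank 56b1(ℚ) = 0` in the kernel**. Everything is
re-verified by the kernel (`decide` on `ℤ/16`, `ℤ/7`); theorems only, no `def`, no named fact introduced. Closes nothing
at the `∀`-level; BSD is not proved by any of this.

WHAT IS PROVED (0 `def`, 0 `sorry`): `twoIsogenySelmerGroup_E'_subset`, `twoIsogenySelmerGroup'_E'_subset`,
`mordellWeilRank_E'` (`= 0`), `forall_mem_sha_E'_two_smul_eq_zero` (`Ш(E′)[2] = 0`), `mordellWeilRank_C56B1` (`= 0`),
`shaCorank_C56B1_two` / `finite_primaryComponent_sha_C56B1_two` (`Ш(56b1)[2^∞]` finite, unconditionally),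
and `printFamily56b1_of_thm15_certified` — `printFamily56b1_of_thm15_kernelIsogeny` with `hSha'` discharged: the
remaining displayed base data are the optimal datum (`Dt`, `hopt`), the record `ord₂(L(56b1,1)/Ω) = −1` and `BSD(56b1, 2)`.

References: [SilvermanAEC2009] Prop. X.4.9, Example X.4.10 (congruence method), Prop. X.4.7 with Thm. X.4.2(a), III.4.5,
III.6; [SilvermanTate2015] §3.6; [CaiLiZhai2019] Thm. 1.1, Thm. 1.5; [AgasheRibetStein2006] Thm. 2.6.
-/

set_option autoImplicit false
set_option linter.dupNamespace false

noncomputable section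

open scoped Classical

open WeierstrassCurve Literature.NumberTheory.EllipticCurves
  Literature.NumberTheory.EllipticCurves.Rank1Residual
  Literature.NumberTheory.EllipticCurves.Rank1Residual.Typed
  Literature.NumberTheory.EllipticCurves.CaiLiZhai2019
  Literature.NumberTheory.EllipticCurves.ModularForms
  Literature.NumberTheory.EllipticCurves.AgasheRibetStein2006
  Summit.BirchSwinnertonDyer.Rank1Residual
  Summit.BirchSwinnertonDyer.Rank1Residual.X5.O1
  Summit.BirchSwinnertonDyer.Rank1Residual.P2

namespace Summit.BirchSwinnertonDyer.BirchSwinnertonDyer.Theorems.AddPotGoodPrint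

/-! ## §0 The curve `E′ = E_{−10,−7}` and its half-model -/

/-- `b(a² − 4b) = −7·128 ≠ 0` for `E′ = E_{−10,−7}`. [cite: SilvermanAEC2009, Prop. X.4.9] -/
theorem habE' : (-7 : ℤ) * ((-10 : ℤ) ^ 2 - 4 * (-7)) ≠ 0 := by norm_num

/-- The tree's literal `E_{−10,−7}` is `E′ = [0,−10,0,−7,0]`. [cite: SilvermanAEC2009, Prop. X.4.9] -/
private theorem lit_E' : (⟨0, ((-10 : ℤ) : ℚ), 0, ((-7 : ℤ) : ℚ), 0⟩ : WeierstrassCurve ℚ) = ⟨0, -10, 0, -7, 0⟩ := by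
  ext <;> push_cast <;> ring

/-- The half-model literal for `(a,b) = (−10,−7)` is `[0,5,0,8,0]` (= `56b1` translated, `shift_C56B1_eq`).
[cite: SilvermanAEC2009, Prop. X.4.9] -/
private theorem lit_V₀E' :
    (⟨0, -((-10 : ℤ) : ℚ) / 2, 0, (((-10 : ℤ) : ℚ) ^ 2 - 4 * (-7 : ℤ)) / 16, 0⟩ : WeierstrassCurve ℚ) =
      ⟨0, 5, 0, 8, 0⟩ := by
  ext <;> push_cast <;> ring

/-- `E′ = [0,−10,0,−7,0]` is an elliptic curve (`Δ = 2¹¹·7²`). [cite: SilvermanAEC2009, Prop. X.4.9] -/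
theorem isElliptic_E' : (⟨0, -10, 0, -7, 0⟩ : WeierstrassCurve ℚ).IsElliptic := by
  rw [← lit_E']; exact isElliptic_mk_of_ne_zero (F := ℚ) habE'

/-- The half-model `[0,5,0,8,0]` is an elliptic curve. [cite: SilvermanAEC2009, Prop. X.4.9] -/
theorem isElliptic_V₀E' : (⟨0, 5, 0, 8, 0⟩ : WeierstrassCurve ℚ).IsElliptic := by
  rw [← lit_V₀E']; exact isElliptic_halfModel habE'

/-! ## §1 The sharp descent on `E′`: `S(−10,−7) ⊆ {1,−7}`, `S(20,128) ⊆ {1,2}` -/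

/-- `S(−10, −7)` does not contain `d = −1, 7`: neither chart of the homogeneous space has a point modulo `16`.
[cite: SilvermanAEC2009, Example X.4.10 (the congruence method)] -/
theorem not_mem_S_E' :
    (-1 : ℤ) ∉ twoIsogenySelmerGroup (-10) (-7) ∧ (7 : ℤ) ∉ twoIsogenySelmerGroup (-10) (-7) := by
  have hB : (-7 : ℤ) ≠ 0 := by norm_num
  haveI : Fact (Nat.Prime 2) := ⟨Nat.prime_two⟩
  refine ⟨?_, ?_⟩
  · refine Carrier6137.not_mem_twoIsogenySelmerGroup_of_not_isSoluble hB 2 ?_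
    rw [show (-7 : ℤ) / -1 = 7 by norm_num]
    exact Carrier6137.not_isSoluble_padic_twoIsogenyQuartic_of_zmodPow 4 (by decide +kernel)
  · refine Carrier6137.not_mem_twoIsogenySelmerGroup_of_not_isSoluble hB 2 ?_
    rw [show (-7 : ℤ) / 7 = -1 by norm_num]
    exact Carrier6137.not_isSoluble_padic_twoIsogenyQuartic_of_zmodPow 4 (by decide +kernel)

/-- A squarefree integer dividing `−7` is `±1` or `±7`. [cite: SilvermanAEC2009, Prop. X.4.9] -/
private theorem mem_of_dvd_bE' {d : ℤ} (hd : d ∣ (-7 : ℤ)) : d ∈ ({1, -1, 7, -7} : Finset ℤ) := by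
  have h1 : d.natAbs ∣ 7 := by
    have := Int.natAbs_dvd_natAbs.mpr hd
    simpa using this
  have h2 : d.natAbs ∈ Nat.divisors 7 := Nat.mem_divisors.mpr ⟨h1, by norm_num⟩
  rw [show Nat.divisors 7 = {1, 7} by decide] at h2
  simp only [Finset.mem_insert, Finset.mem_singleton] at h2 ⊢
  rcases Int.natAbs_eq d with h | h <;> rw [h] <;> rcases h2 with h2 | h2 <;> simp [h2]

/-- **`S(−10, −7) ⊆ {1, −7}`** (the images of `O` and `T = (0,0)`). [cite: SilvermanAEC2009, Prop. X.4.9 and Example X.4.10] -/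
theorem twoIsogenySelmerGroup_E'_subset : twoIsogenySelmerGroup (-10) (-7) ⊆ ({1, -7} : Finset ℤ) := by
  intro d hd
  obtain ⟨-, hdvd, -⟩ := (mem_twoIsogenySelmerGroup_iff (a := -10) (by norm_num : (-7 : ℤ) ≠ 0)).mp hd
  have hmem := mem_of_dvd_bE' hdvd
  obtain ⟨hm1, h7⟩ := not_mem_S_E'
  simp only [Finset.mem_insert, Finset.mem_singleton] at hmem ⊢
  rcases hmem with rfl | rfl | rfl | rfl
  · simp
  · exact absurd hd hm1
  · exact absurd hd h7
  · simp

/-- `S(20, 128)` does not contain `d = −1, −2`: neither chart has a point modulo `7`.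
[cite: SilvermanAEC2009, Example X.4.10 (the congruence method)] -/
theorem not_mem_S'_E' :
    (-1 : ℤ) ∉ twoIsogenySelmerGroup 20 128 ∧ (-2 : ℤ) ∉ twoIsogenySelmerGroup 20 128 := by
  have hB : (128 : ℤ) ≠ 0 := by norm_num
  haveI : Fact (Nat.Prime 7) := ⟨by norm_num⟩
  refine ⟨?_, ?_⟩
  · refine Carrier6137.not_mem_twoIsogenySelmerGroup_of_not_isSoluble hB 7 ?_
    rw [show (128 : ℤ) / -1 = -128 by norm_num]
    exact Carrier6137.not_isSoluble_padic_twoIsogenyQuartic_of_zmodPow 1 (by decide)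
  · refine Carrier6137.not_mem_twoIsogenySelmerGroup_of_not_isSoluble hB 7 ?_
    rw [show (128 : ℤ) / -2 = -64 by norm_num]
    exact Carrier6137.not_isSoluble_padic_twoIsogenyQuartic_of_zmodPow 1 (by decide)

/-- A squarefree integer dividing `128 = 2⁷` is `±1` or `±2`. [cite: SilvermanAEC2009, Prop. X.4.9] -/
private theorem mem_of_dvd_bE'' {d : ℤ} (hsq : Squarefree d) (hd : d ∣ (128 : ℤ)) :
    d ∈ ({1, -1, 2, -2} : Finset ℤ) := by
  have hrad : d ∣ 2 := by
    have h7 : d ∣ (2 : ℤ) ^ 7 := by norm_num at hd ⊢; exact hd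
    exact (hsq.dvd_pow_iff_dvd (by norm_num)).mp h7
  have h1 : d.natAbs ∣ 2 := by
    have := Int.natAbs_dvd_natAbs.mpr hrad
    simpa using this
  have h2 : d.natAbs ∈ Nat.divisors 2 := Nat.mem_divisors.mpr ⟨h1, by norm_num⟩
  rw [show Nat.divisors 2 = {1, 2} by decide] at h2
  simp only [Finset.mem_insert, Finset.mem_singleton] at h2 ⊢
  rcases Int.natAbs_eq d with h | h <;> rw [h] <;> rcases h2 with h2 | h2 <;> simp [h2]

/-- **`S′ = S(20, 128) ⊆ {1, 2}`** (the images of `O` and `T′ = (0,0)`). [cite: SilvermanAEC2009, Prop. X.4.9 and Example X.4.10] -/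
theorem twoIsogenySelmerGroup'_E'_subset : twoIsogenySelmerGroup 20 128 ⊆ ({1, 2} : Finset ℤ) := by
  intro d hd
  obtain ⟨hsq, hdvd, -⟩ := (mem_twoIsogenySelmerGroup_iff (a := 20) (by norm_num : (128 : ℤ) ≠ 0)).mp hd
  have hmem := mem_of_dvd_bE'' hsq hdvd
  obtain ⟨hm1, hm2⟩ := not_mem_S'_E'
  simp only [Finset.mem_insert, Finset.mem_singleton] at hmem ⊢
  rcases hmem with rfl | rfl | rfl | rfl
  · simp
  · exact absurd hd hm1
  · simp
  · exact absurd hd hm2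

/-- `2^k ≤ 2^n` forces `k ≤ n`. [folklore] -/
private theorem le_of_two_pow_le {k n : ℕ} (h : 2 ^ k ≤ 2 ^ n) : k ≤ n :=
  (Nat.pow_le_pow_iff_right (by norm_num)).mp h

/-- **`dim₂ S(−10,−7) ≤ 1` and `dim₂ S′(−10,−7) ≤ 1`.** [cite: SilvermanAEC2009, Prop. X.4.9] -/
theorem twoIsogenySelmerRank_E'_le :
    twoIsogenySelmerRank (-10) (-7) ≤ 1 ∧ twoIsogenySelmerRank' (-10) (-7) ≤ 1 := by
  constructor
  · apply le_of_two_pow_le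
    rw [two_pow_twoIsogenySelmerRank_eq_card habE']
    exact (Finset.card_le_card twoIsogenySelmerGroup_E'_subset).trans (by decide)
  · apply le_of_two_pow_le
    rw [two_pow_twoIsogenySelmerRank'_eq_card habE', twoIsogenySelmerGroup'_eq,
      show (-2 * (-10) : ℤ) = 20 by norm_num, show ((-10 : ℤ) ^ 2 - 4 * (-7) : ℤ) = 128 by norm_num]
    exact (Finset.card_le_card twoIsogenySelmerGroup'_E'_subset).trans (by decide)

/-! ## §2 Consequences: `rank E′(ℚ) = 0`, `Ш(E′/ℚ)[2] = 0`, `rank 56b1(ℚ) = 0` -/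

/-- **`rank E′(ℚ) = 0`** for `E′ : y² = x³ − 10x² − 7x`: `rank + 2 ≤ dim₂ S + dim₂ S′ ≤ 1 + 1`.
[cite: SilvermanTate2015, §3.6] [cite: SilvermanAEC2009, Prop. X.4.7 with Thm. X.4.2(a)] -/
theorem mordellWeilRank_E' : (⟨0, -10, 0, -7, 0⟩ : WeierstrassCurve ℚ).mordellWeilRank = 0 := by
  haveI := isElliptic_E'
  have h := twoIsogeny_mordellWeilRank_add_two_le_holds (-10) (-7) habE'
  rw [lit_E'] at h
  have h2 := twoIsogenySelmerRank_E'_le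
  omega

/-- **The descent on `E′` is sharp**: `dim₂ S + dim₂ S′ ≤ rank + 2`. [cite: SilvermanAEC2009, Prop. X.4.7 with Thm. X.4.2(a)] -/
theorem twoIsogenySelmerRank_E'_add_le_rank :
    twoIsogenySelmerRank (-10) (-7) + twoIsogenySelmerRank' (-10) (-7) ≤
      (⟨0, ((-10 : ℤ) : ℚ), 0, ((-7 : ℤ) : ℚ), 0⟩ : WeierstrassCurve ℚ).mordellWeilRank + 2 := by
  have h := twoIsogenySelmerRank_E'_le
  omega

/-- **`Ш(E′/ℚ)[2] = 0`** for `E′ = [0,−10,0,−7,0]` — CLZ Thm. 1.5's certificate «`Ш(E′)[2] = 0`» at the base `56b1`,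
IN THE KERNEL. [cite: SilvermanAEC2009, Prop. X.4.7 with Thm. X.4.2(a)] [cite: CaiLiZhai2019, Thm. 1.5 (hypothesis Ш(E′)[2] = 0)] -/
theorem forall_mem_sha_E'_two_smul_eq_zero :
    ∀ c ∈ (⟨0, -10, 0, -7, 0⟩ : WeierstrassCurve ℚ).sha, 2 • c = 0 → c = 0 := by
  haveI : (⟨0, -((-10 : ℤ) : ℚ) / 2, 0, (((-10 : ℤ) : ℚ) ^ 2 - 4 * (-7 : ℤ)) / 16, 0⟩ :
      WeierstrassCurve ℚ).IsElliptic := by rw [lit_V₀E']; exact isElliptic_V₀E'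
  haveI : (⟨0, ((-10 : ℤ) : ℚ), 0, ((-7 : ℤ) : ℚ), 0⟩ : WeierstrassCurve ℚ).IsElliptic := by
    rw [lit_E']; exact isElliptic_E'
  have h := forall_mem_sha_two_smul_eq_zero_of_selmerRank_add_le (a := -10) (b := -7) habE'
    twoIsogenySelmerRank_E'_add_le_rank
  rwa [lit_E'] at h

/-- **`Ш(E′/ℚ)(2) = ⊥`** (no element of order `2`, hence trivial `2`-primary part). [cite: SilvermanAEC2009, Prop. X.4.7 with Thm. X.4.2(a)] -/
theorem shaCorank_E'_two : (⟨0, -10, 0, -7, 0⟩ : WeierstrassCurve ℚ).shaCorank 2 = 0 := by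
  haveI := isElliptic_E'
  haveI : Fact (Nat.Prime 2) := ⟨Nat.prime_two⟩
  exact shaCorank_eq_zero_of_forall _ 2 forall_mem_sha_E'_two_smul_eq_zero

/-- **`56b1 ~ E′` over `ℚ`** (translation to two-torsion normal form, then the explicit `2`-isogeny).
[cite: SilvermanAEC2009, III.4.5 and III.6] -/
theorem isIsogenous_C56B1_E' [C56B1.IsElliptic] :
    IsIsogenous C56B1 (⟨0, -10, 0, -7, 0⟩ : WeierstrassCurve ℚ) := by
  haveI := isTwoTorsionNF_shift_C56B1
  have h1 : IsIsogenous C56B1 ((⟨1, 2, 0, 0⟩ : VariableChange ℚ) • C56B1) := isIsogenous_smul C56B1 _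
  have h2 : IsIsogenous ((⟨1, 2, 0, 0⟩ : VariableChange ℚ) • C56B1) (⟨0, -10, 0, -7, 0⟩ : WeierstrassCurve ℚ) :=
    isIsogenous_of_eq_twoIsogenyCodomain _ twoIsogenyCodomain_shift_C56B1
  exact h1.trans' h2

/-- **`rank 56b1(ℚ) = 0` — IN THE KERNEL** (rank is an isogeny invariant; `rank E′(ℚ) = 0` by the sharp descent).
[cite: SilvermanTate2015, §3.6] [cite: MilneADT2006, proof of Thm. I.7.3] -/
theorem mordellWeilRank_C56B1 [C56B1.IsElliptic] : C56B1.mordellWeilRank = 0 := by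
  haveI := isElliptic_E'
  rw [isIsogenous_C56B1_E'.mordellWeilRank_eq, mordellWeilRank_E']

/-- **`t₂(56b1) = corank_{ℤ₂} Ш(56b1/ℚ)[2^∞] = 0` — IN THE KERNEL** (`t_p` is an isogeny invariant; `t₂(E′) = 0` by the sharp
descent). [cite: Greenberg1999LNM, §1 pp. 54–57] -/
theorem shaCorank_C56B1_two [C56B1.IsElliptic] : C56B1.shaCorank 2 = 0 := by
  haveI := isElliptic_E'
  haveI : Fact (Nat.Prime 2) := ⟨Nat.prime_two⟩
  rw [isIsogenous_C56B1_E'.shaCorank_eq 2, shaCorank_E'_two]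

/-- **`Ш(56b1/ℚ)[2^∞]` is FINITE — unconditionally, in the kernel.** [cite: Greenberg1999LNM, §1 pp. 54–57] -/
theorem finite_primaryComponent_sha_C56B1_two [C56B1.IsElliptic] :
    Finite (AddCommGroup.primaryComponent C56B1.sha 2) := by
  haveI : Fact (Nat.Prime 2) := ⟨Nat.prime_two⟩
  exact (finite_primaryComponent_sha_iff_shaCorank_eq_zero _ 2).mpr shaCorank_C56B1_two

/-! ## §3 The `56b1` Thm-1.5 road with every `2`-descent datum certified -/

/-- **BSD₂ (both halves, `Ш(W)(2) = 0`) on the `2N`-split sub-family of `56b1^{(∏Q)}` — CLZ Thm. 1.1 + Thm. 1.5 (PROVED) +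
ARS Thm. 2.6, with `#E(ℚ)[2] = 2`, the `2`-isogeny `φ : 56b1 → E′`, `#ker φ = 2` AND `Ш(E′)[2] = 0` ALL IN THE KERNEL.**
Displayed base data left: the optimal datum (`Dt`, `hopt`), the record `ord₂(L(56b1,1)/Ω) = −1` (`hL`) and the certificate
`BSD(56b1, 2)` (`hbase`); twisting data `Q ⊆ 𝒮(56b1)` nonempty and «every `ℓ ∣ 2N` splits in `ℚ(√∏Q)`». Conclusion at every
global minimal `W ≅ 56b1^{(∏Q)}`: `r_an(W) = 0`, `Addv W 2`, `0 ≤ ord₂ j(W)`, `¬CM`, `Red W 2`, `Ш(W)(2) = ⊥`, `BSD(W, 2)`,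
`MissingLowerBoundAt W 2` (C3″'s conclusion), `MissingUpperBoundAt W 2` (C2″'s conclusion). BSD is not proved by any of this.
[cite: CaiLiZhai2019, Thm. 1.1 and Thm. 1.5] [cite: AgasheRibetStein2006, Thm. 2.6] [cite: SilvermanAEC2009, Prop. X.4.7, X.4.9] -/
theorem printFamily56b1_of_thm15_certified (h11 : thm11_ord_two_LAlg_twist) (h15 : thm15_twoPartBSD_twist)
    (h26 : cremona_abs_maninConstant_eq_one_of_level_le) (hmod : hasEntireLFunction_rat)
    (hGZK : rank_eq_analyticRank_of_analyticRank_le_one)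
    [C56B1.IsElliptic] [C56B1.IsGloballyMinimal] [NeZero (C56B1.conductorNorm ℤ)]
    (Dt : ModularParametrizationData C56B1 (C56B1.conductorNorm ℤ))
    (hopt : ∀ z ∈ Dt.L.lattice, ∃ w ∈ periodLattice Dt.f, z = Dt.c * w)
    (hL : ∃ q : ℚ, C56B1.entireLFunction 1 = (q : ℂ) * (C56B1.realPeriodRat : ℂ) ∧ padicValRat 2 q = -1)
    (hbase : BSDp C56B1 2)
    (Q : Finset ℕ) (hQ : Q.Nonempty) (hS : ∀ q ∈ Q, InS C56B1 q)
    (hsplit : ∀ (K : Type) [Field K] [NumberField K], Module.finrank ℚ K = 2 →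
      (∃ x : K, x ^ 2 = ((∏ q ∈ Q, q : ℕ) : K)) → SatisfiesHeegnerHypothesis (2 * C56B1.conductorNorm ℤ) K)
    (W : WeierstrassCurve ℚ) [W.IsElliptic] [W.IsGloballyMinimal]
    (hW : ∃ C : VariableChange ℚ, C • C56B1.quadraticTwist ((∏ q ∈ Q, q : ℕ) : ℚ) = W) :
    W.analyticRank = 0 ∧ Addv W 2 ∧ 0 ≤ padicValRat 2 W.j ∧ ¬ W.HasCM ∧ Red W 2 ∧
      AddCommGroup.primaryComponent W.sha 2 = ⊥ ∧ BSDp W 2 ∧ MissingLowerBoundAt W 2 ∧ MissingUpperBoundAt W 2 :=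
  printFamily56b1_of_thm15_kernelIsogeny h11 h15 h26 hmod hGZK Dt hopt hL forall_mem_sha_E'_two_smul_eq_zero hbase Q hQ
    hS hsplit W hW

end Summit.BirchSwinnertonDyer.BirchSwinnertonDyer.Theorems.AddPotGoodPrint

end
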